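import Literature.NumberTheory.LFunctions.LogFreeDensityTheorem14Zeta
import Literature.NumberTheory.LFunctions.PrimeNumberTheoremVinogradovKorobov
import Mathlib.Analysis.SpecificLimits.Basic
import HarnessLib

/-!
# The zero power sum `Z(N,T) = ∑_{0<|γ|≤T} N^{β−1}` decays along `T = N^ϑ` (VK region × log-free density), PROVED

Topic `Literature/NumberTheory/LFunctions`.  Everything in this file is PROVED from two tree THEOREMS:
the log-free zero-density estimate `LogFreeDensity.logFreeDensity_zeta` (Bombieri 1987, Théorème 14 for `ζ`:
`#{ρ : β ≥ α, 0 < |γ| ≤ P⁶} ≤ C_D P^{c_D(1−α)}`, with multiplicity) and the Vinogradov–Korobov zero-free region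
`VinogradovKorobovPNT.exists_re_le_of_mem_weilZeroIndex` (Ivić 1985, Thm 12.2 (12.26):
`β ≤ 1 − c/((log T)^{2/3}(log log T)^{1/3})` for `0 < |γ| ≤ T`, `T ≥ 21`).  The classical corollary (Ivić 1985,
Ch. 12, the zero-sum step of the PNT in short intervals):

  `Z(N, N^ϑ) := ∑_{ρ : 0 < |γ| ≤ N^ϑ} m(ρ)·N^{β−1} ≤ 2 C_D · exp(−δ_T·log N·(1 − c_D ϑ/3))`,
  `δ_T = c/((ϑ log N)^{2/3}(log(ϑ log N))^{1/3})`,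

valid for `0 < ϑ < 3/c_D`, `N ≥ 1`, `N^ϑ ≥ 64`, once the exponent is `≥ 1` (it tends to `∞` like `(log N)^{1/6}`).
DEMANDED by the K_B transition audit of cell ls-idea (U3-AUDIT §2/§7, `Z_le_deltaVK`): the zeros owe only
`Z(N, N^{η+ε}) = o((log N)^{−A})`, which this supplies — NOT a zero-free box, NOT a power saving.

PROOF.  Dyadic shells in `1 − β`: every zero has `δ_T ≤ 1 − β ≤ 1`; a zero with `2^j δ_T ≤ 1 − β` contributes
`N^{β−1} ≤ N^{−2^j δ_T}`, and the shell `1 − β ≤ 2^{j+1}δ_T` holds at most `C_D P^{c_D 2^{j+1} δ_T}` zeros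
(`P = T^{1/6}`); so `Z ≤ C_D ∑_j exp(−2^j a)`, `a = δ_T(log N − 2 c_D log P) = δ_T log N (1 − c_Dϑ/3)`, and
`∑_{j≥0} e^{−2^j a} ≤ e^{−a} ∑_j 2^{−j} ≤ 2e^{−a}` for `a ≥ 1` (abstract lemmas `dyadic_bound`, `sum_exp_two_pow_le`).

## References
* [Ivic1985] A. Ivić, *The Riemann zeta-function*, Wiley 1985, Thm 12.2 and Ch. 12 (zero sums `∑ x^{β−1}`).
* [Bombieri1987GrandCrible] E. Bombieri, *Le grand crible dans la théorie analytique des nombres*, Astérisque 18,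
  §6 Théorème 14.
-/

noncomputable section

open Finset Real

namespace Literature.NumberTheory.LFunctions

namespace ZeroPowerSum

/-- The ZERO POWER SUM `Z(N,T) = ∑_{ρ : ζ(ρ) = 0, 0 ≤ β ≤ 1, 0 < |γ| ≤ T} m(ρ)·N^{β−1}` (multiplicity `m(ρ)`).
[cite: Ivic1985, Ch. 12 (zero sums in the PNT for short intervals) — derivation] -/
def Z (N T : ℝ) : ℝ :=
  ∑ ρ ∈ (weilZeroIndex_finite T).toFinset, (riemannZetaZeroOrder ρ : ℝ) * N ^ (ρ.re - 1)

/-- `Z(N,T) ≥ 0`. [cite: Ivic1985, Ch. 12 — derivation] -/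
theorem Z_nonneg {N : ℝ} (hN : 0 ≤ N) (T : ℝ) : 0 ≤ Z N T := by
  unfold Z
  refine Finset.sum_nonneg fun ρ hρ => mul_nonneg ?_ (Real.rpow_nonneg hN _)
  have hmem := (Set.Finite.mem_toFinset _).mp hρ
  have hρ1 : ρ ≠ 1 := fun h => hmem.2.2.2.1 (by simp [h])
  exact_mod_cast riemannZetaZeroOrder_nonneg hρ1

/-! ### Abstract dyadic lemma -/

/-- DYADIC SHELLS.  Weights `w_i ≥ 0`, exponents `δ ≤ d_i ≤ 1`, counts `∑_{d_i ≤ t} w_i ≤ C B^t` (`0 ≤ t ≤ 1`),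
`N ≥ 1`, and `2^{J+1} δ > 1`: then `∑ w_i N^{−d_i} ≤ ∑_{j ≤ J} C B^{min(2^{j+1}δ, 1)} N^{−2^j δ}`.
[cite: Ivic1985, Ch. 12 — derivation] -/
theorem dyadic_bound {ι : Type*} (s : Finset ι) (w d : ι → ℝ) (hw : ∀ i ∈ s, 0 ≤ w i)
    {δ : ℝ} (hδ : 0 < δ) (hd : ∀ i ∈ s, δ ≤ d i) (hd1 : ∀ i ∈ s, d i ≤ 1)
    {N : ℝ} (hN : 1 ≤ N) {C B : ℝ}
    (hcount : ∀ t : ℝ, 0 ≤ t → t ≤ 1 → ∑ i ∈ s with d i ≤ t, w i ≤ C * B ^ t)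
    (J : ℕ) (hJ : 1 < 2 ^ (J + 1) * δ) :
    ∑ i ∈ s, w i * N ^ (-(d i)) ≤
      ∑ j ∈ range (J + 1), C * B ^ (min (2 ^ (j + 1) * δ) 1) * N ^ (-(2 ^ j * δ)) := by
  classical
  -- shell membership predicate
  let P : ℕ → ι → Prop := fun j i => 2 ^ j * δ ≤ d i ∧ d i ≤ min (2 ^ (j + 1) * δ) 1
  -- (1) each term is dominated by the sum over its shells
  have hterm : ∀ i ∈ s, w i * N ^ (-(d i)) ≤
      ∑ j ∈ range (J + 1), (if P j i then w i * N ^ (-(2 ^ j * δ)) else 0) := by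
    intro i hi
    -- the largest j ≤ J with 2^j δ ≤ d i
    obtain ⟨j₀, hj₀mem, hj₀max⟩ := Finset.exists_max_image ((range (J + 1)).filter fun j => 2 ^ j * δ ≤ d i)
      (fun j => j) ⟨0, by simp [hd i hi]⟩
    rw [Finset.mem_filter, Finset.mem_range] at hj₀mem
    have hP : P j₀ i := by
      refine ⟨hj₀mem.2, le_min ?_ (hd1 i hi)⟩
      by_cases hJ' : j₀ + 1 < J + 1
      · by_contra hlt
        have h' : 2 ^ (j₀ + 1) * δ ≤ d i := le_of_not_ge hlt
        have := hj₀max (j₀ + 1) (by rw [Finset.mem_filter, Finset.mem_range]; exact ⟨hJ', h'⟩)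
        omega
      · have hj : j₀ = J := by omega
        subst hj
        linarith [hd1 i hi]
    have hle : w i * N ^ (-(d i)) ≤ w i * N ^ (-(2 ^ j₀ * δ)) :=
      mul_le_mul_of_nonneg_left (Real.rpow_le_rpow_of_exponent_le hN (by linarith [hP.1])) (hw i hi)
    refine hle.trans ?_
    rw [← Finset.sum_filter]
    have hmem : j₀ ∈ (range (J + 1)).filter (fun j => P j i) := by
      rw [Finset.mem_filter, Finset.mem_range]; exact ⟨hj₀mem.1, hP⟩
    exact Finset.single_le_sum (f := fun j => w i * N ^ (-(2 ^ j * δ)))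
      (fun j _ => mul_nonneg (hw i hi) (Real.rpow_nonneg (by linarith) _)) hmem
  -- (2) sum over i, swap, bound each shell by the count
  calc ∑ i ∈ s, w i * N ^ (-(d i))
      ≤ ∑ i ∈ s, ∑ j ∈ range (J + 1), (if P j i then w i * N ^ (-(2 ^ j * δ)) else 0) :=
        Finset.sum_le_sum hterm
    _ = ∑ j ∈ range (J + 1), ∑ i ∈ s, (if P j i then w i * N ^ (-(2 ^ j * δ)) else 0) := Finset.sum_comm
    _ ≤ ∑ j ∈ range (J + 1), C * B ^ (min (2 ^ (j + 1) * δ) 1) * N ^ (-(2 ^ j * δ)) := by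
        refine Finset.sum_le_sum fun j _ => ?_
        rw [← Finset.sum_filter]
        have hsub : (s.filter fun i => P j i) ⊆ s.filter fun i => d i ≤ min (2 ^ (j + 1) * δ) 1 := by
          intro i hi
          rw [Finset.mem_filter] at hi ⊢
          exact ⟨hi.1, hi.2.2⟩
        calc ∑ i ∈ s.filter (fun i => P j i), w i * N ^ (-(2 ^ j * δ))
            = (∑ i ∈ s.filter (fun i => P j i), w i) * N ^ (-(2 ^ j * δ)) := by rw [Finset.sum_mul]
          _ ≤ (∑ i ∈ s.filter (fun i => d i ≤ min (2 ^ (j + 1) * δ) 1), w i) * N ^ (-(2 ^ j * δ)) := by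
              refine mul_le_mul_of_nonneg_right ?_ (Real.rpow_nonneg (by linarith) _)
              exact Finset.sum_le_sum_of_subset_of_nonneg hsub fun i hi _ => hw i (Finset.mem_filter.mp hi).1
          _ ≤ C * B ^ (min (2 ^ (j + 1) * δ) 1) * N ^ (-(2 ^ j * δ)) := by
              refine mul_le_mul_of_nonneg_right ?_ (Real.rpow_nonneg (by linarith) _)
              exact hcount _ (le_min (by positivity) zero_le_one) (min_le_right _ _)

/-- `∑_{j ≤ J} e^{−2^j a} ≤ 2 e^{−a}` for `a ≥ 1` (compare with `e^{−a} 2^{−j}`). [folklore] -/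
private theorem sum_exp_two_pow_le {a : ℝ} (ha : 1 ≤ a) (J : ℕ) :
    ∑ j ∈ range (J + 1), Real.exp (-(2 ^ j * a)) ≤ 2 * Real.exp (-a) := by
  have hlog2 : Real.log 2 < 1 := by
    have := Real.log_two_lt_d9; linarith
  have hterm : ∀ j : ℕ, Real.exp (-(2 ^ j * a)) ≤ Real.exp (-a) * (1 / 2) ^ j := by
    intro j
    have h2j : (j : ℝ) + 1 ≤ 2 ^ j := by exact_mod_cast Nat.succ_le_of_lt Nat.lt_two_pow_self
    have hpow : ((1:ℝ) / 2) ^ j = Real.exp (-(j * Real.log 2)) := by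
      rw [Real.exp_neg, ← Real.log_rpow (by norm_num : (0:ℝ) < 2), Real.rpow_natCast,
        Real.exp_log (by positivity)]
      simp
    rw [hpow, ← Real.exp_add, Real.exp_le_exp]
    -- need: -(2^j a) ≤ -a - j log 2, i.e. a + j log 2 ≤ 2^j a
    have : (j : ℝ) * Real.log 2 ≤ j * a := by
      have hj : (0:ℝ) ≤ j := Nat.cast_nonneg j
      nlinarith
    nlinarith
  calc ∑ j ∈ range (J + 1), Real.exp (-(2 ^ j * a))
      ≤ ∑ j ∈ range (J + 1), Real.exp (-a) * (1 / 2) ^ j := Finset.sum_le_sum fun j _ => hterm j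
    _ = Real.exp (-a) * ∑ j ∈ range (J + 1), ((1:ℝ) / 2) ^ j := by rw [Finset.mul_sum]
    _ ≤ Real.exp (-a) * 2 := mul_le_mul_of_nonneg_left (sum_geometric_two_le _) (Real.exp_pos _).le
    _ = 2 * Real.exp (-a) := by ring

/-- GEOMETRIC STEP: with `N, B ≥ 1`, `a := δ(log N − 2 log B) ≥ 1`, the dyadic majorant is `≤ 2 C e^{−a}`.
[cite: Ivic1985, Ch. 12 — derivation] -/
theorem dyadic_sum_le {C B N δ : ℝ} (hC : 0 ≤ C) (hB : 1 ≤ B) (hN : 1 ≤ N) (J : ℕ)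
    (ha : 1 ≤ δ * (Real.log N - 2 * Real.log B)) :
    ∑ j ∈ range (J + 1), C * B ^ (min (2 ^ (j + 1) * δ) 1) * N ^ (-(2 ^ j * δ)) ≤
      2 * C * Real.exp (-(δ * (Real.log N - 2 * Real.log B))) := by
  set a := δ * (Real.log N - 2 * Real.log B) with ha_def
  have hterm : ∀ j : ℕ, C * B ^ (min (2 ^ (j + 1) * δ) 1) * N ^ (-(2 ^ j * δ)) ≤ C * Real.exp (-(2 ^ j * a)) := by
    intro j
    have h1 : B ^ (min (2 ^ (j + 1) * δ) 1) ≤ B ^ (2 ^ (j + 1) * δ) :=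
      Real.rpow_le_rpow_of_exponent_le hB (min_le_left _ _)
    have h2 : B ^ (2 ^ (j + 1) * δ) * N ^ (-(2 ^ j * δ)) = Real.exp (-(2 ^ j * a)) := by
      rw [Real.rpow_def_of_pos (by linarith), Real.rpow_def_of_pos (by linarith), ← Real.exp_add, ha_def]
      congr 1; ring
    calc C * B ^ (min (2 ^ (j + 1) * δ) 1) * N ^ (-(2 ^ j * δ))
        ≤ C * B ^ (2 ^ (j + 1) * δ) * N ^ (-(2 ^ j * δ)) := by
          refine mul_le_mul_of_nonneg_right (mul_le_mul_of_nonneg_left h1 hC) (Real.rpow_nonneg (by linarith) _)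
      _ = C * Real.exp (-(2 ^ j * a)) := by rw [mul_assoc, h2]
  calc ∑ j ∈ range (J + 1), C * B ^ (min (2 ^ (j + 1) * δ) 1) * N ^ (-(2 ^ j * δ))
      ≤ ∑ j ∈ range (J + 1), C * Real.exp (-(2 ^ j * a)) := Finset.sum_le_sum fun j _ => hterm j
    _ = C * ∑ j ∈ range (J + 1), Real.exp (-(2 ^ j * a)) := by rw [Finset.mul_sum]
    _ ≤ C * (2 * Real.exp (-a)) := mul_le_mul_of_nonneg_left (sum_exp_two_pow_le ha J) hC
    _ = 2 * C * Real.exp (-a) := by ring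

/-! ### The zero power sum along `T = N^ϑ` -/

/-- **`Z_le_deltaVK`** (explicit-hypothesis form).  There are `c_D, C_D, c > 0` (the tree's log-free density and
Vinogradov–Korobov constants) such that for `0 < ϑ`, `c_D ϑ < 3`, `N ≥ 1`, `N^ϑ ≥ 64` and exponent
`a := δ_T · log N · (1 − c_D ϑ/3) ≥ 1`, `δ_T = c/((log T)^{2/3}(log log T)^{1/3})`, `T = N^ϑ`:
`Z(N, N^ϑ) ≤ 2 C_D e^{−a}`. [cite: Ivic1985, Theorem 12.2 eq. (12.26) — derivation] -/
theorem Z_le_deltaVK : ∃ c_D C_D c : ℝ, 0 < c_D ∧ 0 < C_D ∧ 0 < c ∧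
    ∀ ϑ : ℝ, 0 < ϑ → c_D * ϑ < 3 → ∀ N : ℝ, 1 ≤ N → 64 ≤ N ^ ϑ →
      1 ≤ c / (Real.log (N ^ ϑ) ^ (2 / 3 : ℝ) * Real.log (Real.log (N ^ ϑ)) ^ (1 / 3 : ℝ)) *
            Real.log N * (1 - c_D * ϑ / 3) →
      Z N (N ^ ϑ) ≤ 2 * C_D * Real.exp (-(c / (Real.log (N ^ ϑ) ^ (2 / 3 : ℝ) *
          Real.log (Real.log (N ^ ϑ)) ^ (1 / 3 : ℝ)) * Real.log N * (1 - c_D * ϑ / 3))) := by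
  obtain ⟨c_D, C_D, hc_D, hC_D, hdens⟩ := LogFreeDensity.logFreeDensity_zeta
  obtain ⟨c, hc, hVK⟩ := VinogradovKorobovPNT.exists_re_le_of_mem_weilZeroIndex
  refine ⟨c_D, C_D, c, hc_D, hC_D, hc, fun ϑ hϑ hcϑ N hN hT ha => ?_⟩
  set T : ℝ := N ^ ϑ with hTdef
  have hN0 : 0 < N := by linarith
  have hT21 : 21 ≤ T := by linarith
  have hT1 : 1 < T := by linarith
  have hlogT : 0 < Real.log T := Real.log_pos hT1
  have hloglogT : 0 < Real.log (Real.log T) := by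
    apply Real.log_pos
    have : Real.exp 1 < T := lt_of_lt_of_le (by have := Real.exp_one_lt_d9; linarith) hT
    have := Real.log_lt_log (Real.exp_pos 1) this
    rwa [Real.log_exp] at this
  set δ : ℝ := c / (Real.log T ^ (2 / 3 : ℝ) * Real.log (Real.log T) ^ (1 / 3 : ℝ)) with hδdef
  have hδ : 0 < δ := by positivity
  -- P = T^{1/6} ≥ 2, B = P^{c_D}
  set P : ℝ := T ^ (1 / 6 : ℝ) with hPdef
  have hP2 : 2 ≤ P := by
    have h64 : (64 : ℝ) ^ (1 / 6 : ℝ) = 2 := by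
      rw [show (64:ℝ) = 2 ^ (6:ℝ) by norm_num, ← Real.rpow_mul (by norm_num)]; norm_num
    rw [hPdef, ← h64]
    exact Real.rpow_le_rpow (by norm_num) hT (by norm_num)
  have hP6 : P ^ (6 : ℕ) = T := by
    rw [hPdef, ← Real.rpow_natCast, ← Real.rpow_mul (by linarith)]; norm_num
  set B : ℝ := P ^ c_D with hBdef
  have hB : 1 ≤ B := Real.one_le_rpow (by linarith) hc_D.le
  -- the zero set, weights, exponents
  set s := (weilZeroIndex_finite T).toFinset with hsdef
  have hmem : ∀ ρ ∈ s, ρ ∈ weilZeroIndex T := fun ρ hρ => (Set.Finite.mem_toFinset _).mp hρ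
  have hw : ∀ ρ ∈ s, (0 : ℝ) ≤ (riemannZetaZeroOrder ρ : ℝ) := by
    intro ρ hρ
    have hρ1 : ρ ≠ 1 := fun h => (hmem ρ hρ).2.2.2.1 (by simp [h])
    exact_mod_cast riemannZetaZeroOrder_nonneg hρ1
  have hd : ∀ ρ ∈ s, δ ≤ 1 - ρ.re := by
    intro ρ hρ
    have := hVK T hT21 ρ hρ
    rw [hδdef]; linarith
  have hd1 : ∀ ρ ∈ s, 1 - ρ.re ≤ 1 := fun ρ hρ => by linarith [(hmem ρ hρ).2.1]
  -- counts from the log-free density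
  have hcount : ∀ t : ℝ, 0 ≤ t → t ≤ 1 →
      ∑ ρ ∈ s with (1 - ρ.re ≤ t), (riemannZetaZeroOrder ρ : ℝ) ≤ C_D * B ^ t := by
    intro t ht0 ht1
    have h := hdens P hP2 (1 - t) (by linarith) (by linarith)
    have hs' : (weilZeroIndex_finite (P ^ 6)).toFinset = s := by rw [hsdef, hP6]
    rw [hs'] at h
    have hfilt : (s.filter fun ρ => 1 - t ≤ ρ.re) = s.filter fun ρ => 1 - ρ.re ≤ t :=
      Finset.filter_congr fun ρ _ => by constructor <;> intro h' <;> linarith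
    rw [hfilt] at h
    have hBt : B ^ t = P ^ (c_D * (1 - (1 - t))) := by
      rw [hBdef, ← Real.rpow_mul (by linarith)]; ring_nf
    rw [hBt]
    exact_mod_cast h
  -- J with 2^{J+1} δ > 1
  obtain ⟨J, hJ⟩ : ∃ J : ℕ, 1 < 2 ^ (J + 1) * δ := by
    obtain ⟨n, hn⟩ := exists_nat_gt (1 / δ)
    refine ⟨n, ?_⟩
    have h2n : (n : ℝ) + 1 ≤ 2 ^ (n + 1) := by
      have := (Nat.lt_two_pow_self (n := n + 1)).le
      exact_mod_cast (by omega : n + 1 ≤ 2 ^ (n + 1))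
    rw [div_lt_iff₀ hδ] at hn
    nlinarith
  -- assemble
  have hZ : Z N T = ∑ ρ ∈ s, (riemannZetaZeroOrder ρ : ℝ) * N ^ (-(1 - ρ.re)) := by
    unfold Z
    refine Finset.sum_congr rfl fun ρ _ => ?_
    congr 1; congr 1; ring
  have h1 := dyadic_bound s (fun ρ => (riemannZetaZeroOrder ρ : ℝ)) (fun ρ => 1 - ρ.re) hw hδ hd hd1 hN
    hcount J hJ
  have hlogB : Real.log B = c_D * ϑ / 6 * Real.log N := by
    rw [hBdef, Real.log_rpow (by linarith), hPdef, Real.log_rpow (by linarith), hTdef,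
      Real.log_rpow hN0]
    ring
  have ha' : δ * (Real.log N - 2 * Real.log B) = δ * Real.log N * (1 - c_D * ϑ / 3) := by
    rw [hlogB]; ring
  have ha1 : 1 ≤ δ * (Real.log N - 2 * Real.log B) := by rw [ha']; exact ha
  have h2 := dyadic_sum_le hC_D.le hB hN J ha1
  rw [ha'] at h2
  rw [hZ]
  exact h1.trans h2

/-! ### The threshold form: the exponent hypothesis `a ≥ 1` holds for all large `N` -/

/-- ELEMENTARY: for `u ≥ 1`, `(log u)^{1/3} ≤ 2^{1/3} u^{1/6}` (from `log u ≤ 2√u`). [folklore] -/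
private theorem log_rpow_third_le {u : ℝ} (hu : 1 ≤ u) :
    Real.log u ^ (1 / 3 : ℝ) ≤ (2 : ℝ) ^ (1 / 3 : ℝ) * u ^ (1 / 6 : ℝ) := by
  have hu0 : 0 ≤ u := by linarith
  have hlog0 : 0 ≤ Real.log u := Real.log_nonneg hu
  have h1 : Real.log u ≤ 2 * u ^ (1 / 2 : ℝ) := by
    have := Real.log_le_rpow_div hu0 (by norm_num : (0:ℝ) < 1 / 2)
    linarith
  calc Real.log u ^ (1 / 3 : ℝ) ≤ (2 * u ^ (1 / 2 : ℝ)) ^ (1 / 3 : ℝ) :=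
        Real.rpow_le_rpow hlog0 h1 (by norm_num)
    _ = (2 : ℝ) ^ (1 / 3 : ℝ) * u ^ (1 / 6 : ℝ) := by
        rw [Real.mul_rpow (by norm_num) (Real.rpow_nonneg hu0 _), ← Real.rpow_mul hu0]
        norm_num

/-- **`Z_le_deltaVK`, THRESHOLD FORM.**  With the same constants: for every `0 < ϑ` with `c_D ϑ < 3` there is `N₀` such that
for all `N ≥ N₀`, `Z(N, N^ϑ) ≤ 2 C_D · exp(−a(N))`, `a(N) = c·(1 − c_Dϑ/3)·log N / ((log N^ϑ)^{2/3}(log log N^ϑ)^{1/3})`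
(the side conditions `N ≥ 1`, `N^ϑ ≥ 64`, `a(N) ≥ 1` of `Z_le_deltaVK` hold from `ϑ log N ≥ max(log 64, κ⁶)` on,
`κ = 2^{1/3} ϑ / (c(1 − c_Dϑ/3))`, since `a(N) = (c(1 − c_Dϑ/3)/ϑ)·u^{1/3}/(log u)^{1/3}` with `u = ϑ log N` and
`(log u)^{1/3} ≤ 2^{1/3}u^{1/6}`). [cite: Ivic1985, Theorem 12.2 eq. (12.26) — derivation] -/
theorem Z_le_deltaVK_of_large : ∃ c_D C_D c : ℝ, 0 < c_D ∧ 0 < C_D ∧ 0 < c ∧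
    ∀ ϑ : ℝ, 0 < ϑ → c_D * ϑ < 3 → ∃ N₀ : ℝ, ∀ N : ℝ, N₀ ≤ N →
      Z N (N ^ ϑ) ≤ 2 * C_D * Real.exp (-(c / (Real.log (N ^ ϑ) ^ (2 / 3 : ℝ) *
          Real.log (Real.log (N ^ ϑ)) ^ (1 / 3 : ℝ)) * Real.log N * (1 - c_D * ϑ / 3))) := by
  obtain ⟨c_D, C_D, c, hc_D, hC_D, hc, hZ⟩ := Z_le_deltaVK
  refine ⟨c_D, C_D, c, hc_D, hC_D, hc, fun ϑ hϑ hcϑ => ?_⟩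
  -- k = 1 − c_Dϑ/3 > 0, κ = 2^{1/3} ϑ/(c k) and the threshold u₀ in u = ϑ log N
  set k : ℝ := 1 - c_D * ϑ / 3 with hkdef
  have hk : 0 < k := by rw [hkdef]; nlinarith
  have hck : 0 < c * k := mul_pos hc hk
  set κ : ℝ := (2 : ℝ) ^ (1 / 3 : ℝ) * ϑ / (c * k) with hκdef
  have hκ : 0 < κ := by positivity
  set u₀ : ℝ := max (max (Real.log 64) 2) (κ ^ (6 : ℕ)) with hu₀def
  refine ⟨Real.exp (u₀ / ϑ), fun N hN => ?_⟩
  have hN₀pos : 0 < Real.exp (u₀ / ϑ) := Real.exp_pos _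
  have hNpos : 0 < N := lt_of_lt_of_le hN₀pos hN
  have hu₀2 : 2 ≤ u₀ := le_trans (le_max_right _ _) (le_max_left _ _)
  -- u = ϑ log N ≥ u₀
  have hL : u₀ / ϑ ≤ Real.log N := by
    have := Real.log_le_log hN₀pos hN
    rwa [Real.log_exp] at this
  set u : ℝ := ϑ * Real.log N with hudef
  have hu : u₀ ≤ u := by
    have h := (div_le_iff₀ hϑ).mp hL
    rw [hudef]; linarith [mul_comm ϑ (Real.log N)]
  have hu2 : 2 ≤ u := le_trans hu₀2 hu
  have hu1 : 1 ≤ u := by linarith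
  have hu0 : 0 < u := by linarith
  have hlogT : Real.log (N ^ ϑ) = u := by rw [Real.log_rpow hNpos, hudef]
  -- the three side conditions of `Z_le_deltaVK`
  have hN1 : 1 ≤ N := by
    have h0 : 0 ≤ Real.log N := by
      have : 0 ≤ u₀ / ϑ := div_nonneg (by linarith) hϑ.le
      linarith
    rwa [← Real.log_nonneg_iff hNpos]
  have hT64 : 64 ≤ N ^ ϑ := by
    have h1 : Real.log 64 ≤ Real.log (N ^ ϑ) := by
      rw [hlogT]; exact le_trans (le_trans (le_max_left _ _) (le_max_left _ _)) hu
    exact (Real.log_le_log_iff (by norm_num) (Real.rpow_pos_of_pos hNpos ϑ)).mp h1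
  have hlogu : 0 < Real.log u := Real.log_pos (by linarith)
  have hD : 0 < u ^ (2 / 3 : ℝ) * Real.log u ^ (1 / 3 : ℝ) := by positivity
  -- the main inequality: ϑ · u^{2/3} (log u)^{1/3} ≤ c k u
  have hκu : κ ≤ u ^ (1 / 6 : ℝ) := by
    have h6 : (κ ^ (6 : ℕ)) ^ (1 / 6 : ℝ) = κ := by
      rw [← Real.rpow_natCast, ← Real.rpow_mul hκ.le]; norm_num
    rw [← h6]
    exact Real.rpow_le_rpow (by positivity) (le_trans (le_max_right _ _) hu) (by norm_num)
  have hmain : ϑ * (u ^ (2 / 3 : ℝ) * Real.log u ^ (1 / 3 : ℝ)) ≤ c * k * u := by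
    have hckϑ : (2 : ℝ) ^ (1 / 3 : ℝ) * ϑ = κ * (c * k) := by rw [hκdef]; field_simp
    calc ϑ * (u ^ (2 / 3 : ℝ) * Real.log u ^ (1 / 3 : ℝ))
        ≤ ϑ * (u ^ (2 / 3 : ℝ) * ((2 : ℝ) ^ (1 / 3 : ℝ) * u ^ (1 / 6 : ℝ))) := by
          refine mul_le_mul_of_nonneg_left ?_ hϑ.le
          exact mul_le_mul_of_nonneg_left (log_rpow_third_le hu1) (Real.rpow_pos_of_pos hu0 _).le
      _ = (2 : ℝ) ^ (1 / 3 : ℝ) * ϑ * (u ^ (2 / 3 : ℝ) * u ^ (1 / 6 : ℝ)) := by ring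
      _ = κ * (c * k) * (u ^ (2 / 3 : ℝ) * u ^ (1 / 6 : ℝ)) := by rw [hckϑ]
      _ ≤ u ^ (1 / 6 : ℝ) * (c * k) * (u ^ (2 / 3 : ℝ) * u ^ (1 / 6 : ℝ)) := by
          refine mul_le_mul_of_nonneg_right (mul_le_mul_of_nonneg_right hκu hck.le) ?_
          positivity
      _ = c * k * (u ^ (2 / 3 : ℝ) * u ^ (1 / 6 : ℝ) * u ^ (1 / 6 : ℝ)) := by ring
      _ = c * k * u := by
          rw [← Real.rpow_add hu0, ← Real.rpow_add hu0]; norm_num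
  have ha : 1 ≤ c / (Real.log (N ^ ϑ) ^ (2 / 3 : ℝ) * Real.log (Real.log (N ^ ϑ)) ^ (1 / 3 : ℝ)) *
      Real.log N * (1 - c_D * ϑ / 3) := by
    rw [hlogT, ← hkdef]
    have hlogN : Real.log N = u / ϑ := by rw [hudef]; field_simp
    rw [hlogN]
    have hform : c / (u ^ (2 / 3 : ℝ) * Real.log u ^ (1 / 3 : ℝ)) * (u / ϑ) * k
        = (c * k * u) / (ϑ * (u ^ (2 / 3 : ℝ) * Real.log u ^ (1 / 3 : ℝ))) := by
      field_simp
    rw [hform, le_div_iff₀ (by positivity), one_mul]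
    exact hmain
  exact hZ ϑ hϑ hcϑ N hN1 hT64 ha

end ZeroPowerSum

end Literature.NumberTheory.LFunctions
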